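import Summits.QuantumFields.YangMills.Theorems.UV3BranchExpansionKernels
import Mathlib.MeasureTheory.Integral.Bochner.Set
import HarnessLib

/-!
# UV3 ∕ N08 supply — BRANCH (MÖBIUS) EXPANSION, FILE 2: the exact expansion (E) of a guarded multi-step push-forward and its DOMINATION PRINCIPLE (abstract, def-free)

LEAD seat `ym-ust-19936-w1` (gen 12) of crux stmt-QuantumFields-19936 `UnitScaleTilt.HistoryTailL`, cell `ym3-torus`; design note
`Cruxes/HistoryTailL/HTopBranchExpansion.md` (19936 evidence #49).  RECORD CURRENCY (★★OWNER WORDS 84∕85): RECORD-INDEPENDENT KINEMATICS — the abstract half of a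
K-uniform bound `ι_{j,K} ≤ e^{c}•dU_K` for product Haar measure pushed through the guarded block averagings `avT3` («hTop»).  It is read by NO row and NO concluder of
the χ-record `AlphaInputsT3ACv4RecChi` (the 19936 display); it is SUPPLY for NODE O B3's proof of the A-rows `fibre55Win`∕`fibre57LowOn` (if that proof wants a
fibrewise mass envelope) and for Track A's N08 node (k-uniform masses).  Nothing of hTop, of the record, of `HistoryTailL` or of rung R3 is proved here; rung R3 =
SU(2) YM₃ on T³ — NOT d = 4, NOT infinite volume, NOT a mass gap, NOT the Clay problem.

THE ABSTRACT SETTING.  A finite measure space `(Ω, μ)` (the finest field, `dU_j`), a target `Y` (the top field) with a reference measure `ν` (`dU_K`), a finite type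
`ι` of SWITCH SITES (pairs (level, coarse bond)), and for every set of sites `s' : Finset ι` («the history whose EML branches are exactly `s'`») a measurable map
`Φ s' : Ω → Y` (the hybrid composite `Ū^{s'_{K−1}} ∘ ⋯ ∘ Ū^{s'_j}`) and events `F σ s' ⊆ Ω` («the guard of `σ` fires along the hybrid trajectory `s'`»).  The ACTUAL
history `S ω` is characterised by `S ω = s' ↔ ∀ σ, (σ ∈ s' ↔ ω ∈ F σ s')` (in the model: induction on levels — the guard of a site depends only on the branches
below it), and the actual composite is `A ω = Φ (S ω) ω`.
* §1 (E) THE BRANCH EXPANSION: `μ(A⁻¹B) = Σ_{s} Σ_{s'⊆s} (−1)^{|s∖s'|} μ((∩_{σ∈s} F σ s') ∩ (Φ s')⁻¹B)` — the exact partition over actual histories with ONLY the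
  complement guards expanded by inclusion–exclusion (`s` = sites constrained to fire, `s'` = the EML branches among them); no complement event survives.
* §2 DOMINATION: if every `s` in a class `𝓜` has a MUTE site (the summand is unchanged when that site's branch is flipped — lemma (M) of the note, whose engine is
  File 1 §2) then those `s` contribute ZERO, `μ(A⁻¹B) ≤ Σ_{s∉𝓜} Σ_{s'⊆s} μ((∩_{σ∈s}F σ s') ∩ (Φ s')⁻¹B)`, and with per-pattern ACTIVITY weights
  `μ((∩F) ∩ Φ⁻¹B) ≤ w s·ν B` (lemma (A)): ★★★ **`μ.map A ≤ (Σ_{s∉𝓜} 2^{|s|}·w s) • ν`** — the letter in which hTop is assembled (the prefactor is the exploration-tree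
  count (C), K-uniform).
* §3 (A₃) MONOTONE STACKING: along a chain `V_{k+1} = T_k ∘ V_k` of measurable maps between the level spaces `X k`, one-level RESTRICTED push-forward bounds
  `((λ_k)↾E_k).map T_k ≤ c_k • λ_{k+1}` stack to `((λ_0)↾{∀ k<n, V_k ∈ E_k}).map V_n ≤ (∏_{k<n} c_k) • λ_n` — how the per-pattern weight `w s = ∏_k (K_α^{|s'_k|} p_adm^{|s_k|})`
  of lemma (A) is obtained from the one-level resampling bound, by monotonicity alone.
[folklore] measure theory and finite combinatorics; the model-specific inputs (hybrid trajectories of `avT3`, read sets, the distorted-set recursion, the resampling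
activity bound) are NOT here.  0 `sorry`, 0 `def`, 0 `instance`; standard axioms.
-/

set_option autoImplicit false

noncomputable section

open MeasureTheory Set Function
open scoped ENNReal

namespace Summit.QuantumFields.YangMills.Theorems.UV3BranchExpansionDomination

open Summit.QuantumFields.YangMills.Theorems.UV3BranchExpansionKernels (prod_one_sub_eq_sum_powerset alternatingSum_powerset_eq_zero_of_pairing
  sum_sum_powerset_compl_eq)

/-! ## §1 (E) The branch expansion of the actual composite -/

section Expansion

variable {Ω Y ι : Type*} [MeasurableSpace Ω] [MeasurableSpace Y] [Fintype ι] [DecidableEq ι]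
  (μ : Measure Ω) (Φ : Finset ι → Ω → Y) (F : ι → Finset ι → Set Ω) (S : Ω → Finset ι) (A : Ω → Y)

/-- The fibre of the actual history over `s'` is `{ω | ∀ σ, σ ∈ s' ↔ ω ∈ F σ s'}`, hence measurable. [folklore] -/
theorem measurableSet_fiber (hF : ∀ σ s, MeasurableSet (F σ s)) (hS : ∀ ω s, S ω = s ↔ ∀ σ, (σ ∈ s ↔ ω ∈ F σ s)) (s' : Finset ι) :
    MeasurableSet {ω : Ω | S ω = s'} := by
  have hset : {ω : Ω | S ω = s'} = ⋂ σ : ι, (if σ ∈ s' then F σ s' else (F σ s')ᶜ) := by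
    ext ω
    simp only [mem_setOf_eq, mem_iInter, hS ω s']
    refine forall_congr' fun σ => ?_
    by_cases hσ : σ ∈ s'
    · simp [hσ]
    · simp [hσ]
  rw [hset]
  refine MeasurableSet.iInter fun σ => ?_
  by_cases hσ : σ ∈ s'
  · rw [if_pos hσ]; exact hF σ s'
  · rw [if_neg hσ]; exact (hF σ s').compl

/-- The actual composite `A ω = Φ (S ω) ω` is measurable (`A⁻¹B = ⋃_{s'} {S = s'} ∩ (Φ s')⁻¹B`). [folklore] -/
theorem measurable_actual (hΦ : ∀ s, Measurable (Φ s)) (hF : ∀ σ s, MeasurableSet (F σ s))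
    (hS : ∀ ω s, S ω = s ↔ ∀ σ, (σ ∈ s ↔ ω ∈ F σ s)) (hA : ∀ ω, A ω = Φ (S ω) ω) : Measurable A := by
  intro B hB
  have hset : A ⁻¹' B = ⋃ s' : Finset ι, ({ω : Ω | S ω = s'} ∩ Φ s' ⁻¹' B) := by
    ext ω
    simp only [mem_preimage, mem_iUnion, mem_inter_iff, mem_setOf_eq]
    constructor
    · intro h
      exact ⟨S ω, rfl, by rw [← hA ω]; exact h⟩
    · rintro ⟨s', hs', h⟩
      rw [hA ω, hs']
      exact h
  rw [hset]
  exact MeasurableSet.iUnion fun s' => (measurableSet_fiber F S hF hS s').inter (hΦ s' hB)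

omit [MeasurableSpace Ω] in
/-- POINTWISE: the indicator of the fibre `{S = s'}` is `∏_{σ∈s'} 1_{F σ s'} · ∏_{σ∉s'} (1 − 1_{F σ s'})`. [folklore] -/
theorem indicator_fiber_eq_prod (hS : ∀ ω s, S ω = s ↔ ∀ σ, (σ ∈ s ↔ ω ∈ F σ s)) (s' : Finset ι) (ω : Ω) :
    ({ω : Ω | S ω = s'}).indicator (1 : Ω → ℝ) ω =
      (∏ σ ∈ s', (F σ s').indicator (1 : Ω → ℝ) ω) * ∏ σ ∈ Finset.univ \ s', (1 - (F σ s').indicator (1 : Ω → ℝ) ω) := by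
  by_cases h : S ω = s'
  · rw [indicator_of_mem (show ω ∈ {ω : Ω | S ω = s'} from h), Pi.one_apply]
    have hall := (hS ω s').1 h
    have h1 : ∏ σ ∈ s', (F σ s').indicator (1 : Ω → ℝ) ω = 1 :=
      Finset.prod_eq_one fun σ hσ => by rw [indicator_of_mem ((hall σ).1 hσ), Pi.one_apply]
    have h2 : ∏ σ ∈ Finset.univ \ s', (1 - (F σ s').indicator (1 : Ω → ℝ) ω) = 1 :=
      Finset.prod_eq_one fun σ hσ => by
        have hσ' : σ ∉ s' := (Finset.mem_sdiff.1 hσ).2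
        rw [indicator_of_notMem (fun hω => hσ' ((hall σ).2 hω)), sub_zero]
    rw [h1, h2, mul_one]
  · rw [indicator_of_notMem (show ω ∉ {ω : Ω | S ω = s'} from h)]
    have hex : ∃ σ, ¬ (σ ∈ s' ↔ ω ∈ F σ s') := by
      by_contra hcon
      push Not at hcon
      exact h ((hS ω s').2 hcon)
    obtain ⟨σ, hσ⟩ := hex
    by_cases hmem : σ ∈ s'
    · have hω : ω ∉ F σ s' := fun hω => hσ ⟨fun _ => hω, fun _ => hmem⟩
      rw [Finset.prod_eq_zero hmem (by rw [indicator_of_notMem hω]), zero_mul]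
    · have hω : ω ∈ F σ s' := by
        by_contra hω
        exact hσ ⟨fun h' => absurd h' hmem, fun h' => absurd h' hω⟩
      have hσc : σ ∈ Finset.univ \ s' := Finset.mem_sdiff.2 ⟨Finset.mem_univ σ, hmem⟩
      rw [Finset.prod_eq_zero hσc (by rw [indicator_of_mem hω, Pi.one_apply, sub_self]), mul_zero]

omit [MeasurableSpace Ω] [MeasurableSpace Y] [Fintype ι] [DecidableEq ι] in
/-- A product of `{0,1}`-indicators over a finset of sites times the indicator of a preimage is the indicator of the intersection (plumbing). [folklore] -/
theorem prod_indicator_mul_indicator_preimage (s : Finset ι) (E : ι → Set Ω) (f : Ω → Y) (B : Set Y) (ω : Ω) :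
    (∏ σ ∈ s, (E σ).indicator (1 : Ω → ℝ) ω) * (f ⁻¹' B).indicator (1 : Ω → ℝ) ω =
      ((⋂ σ ∈ s, E σ) ∩ f ⁻¹' B).indicator (1 : Ω → ℝ) ω := by
  by_cases hω : ω ∈ (⋂ σ ∈ s, E σ) ∩ f ⁻¹' B
  · rw [indicator_of_mem hω, Pi.one_apply]
    have h1 : ∏ σ ∈ s, (E σ).indicator (1 : Ω → ℝ) ω = 1 :=
      Finset.prod_eq_one fun σ hσ => by
        rw [indicator_of_mem ((mem_iInter₂.1 hω.1) σ hσ), Pi.one_apply]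
    rw [h1, indicator_of_mem hω.2, Pi.one_apply, mul_one]
  · rw [indicator_of_notMem hω]
    rw [mem_inter_iff, not_and_or] at hω
    rcases hω with hω | hω
    · rw [mem_iInter₂] at hω
      push Not at hω
      obtain ⟨σ, hσ, hωσ⟩ := hω
      rw [Finset.prod_eq_zero hσ (indicator_of_notMem hωσ _), zero_mul]
    · rw [indicator_of_notMem hω, mul_zero]

variable [IsFiniteMeasure μ]

/-- ★★★ **(E) THE BRANCH EXPANSION.**  For every measurable `B ⊆ Y`:
`μ(A⁻¹B) = Σ_{s} Σ_{s'⊆s} (−1)^{|s∖s'|} · μ((∩_{σ∈s} F σ s') ∩ (Φ s')⁻¹B)` — the partition over actual histories `{S = s'}` with ONLY the complement guards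
expanded (inclusion–exclusion), regrouped by the constrained set `s ⊇ s'`.  Exact; finite sums; no complement event survives. [folklore] -/
theorem measureReal_preimage_actual_eq_branchExpansion (hΦ : ∀ s, Measurable (Φ s)) (hF : ∀ σ s, MeasurableSet (F σ s))
    (hS : ∀ ω s, S ω = s ↔ ∀ σ, (σ ∈ s ↔ ω ∈ F σ s)) (hA : ∀ ω, A ω = Φ (S ω) ω) {B : Set Y} (hB : MeasurableSet B) :
    μ.real (A ⁻¹' B) =
      ∑ s : Finset ι, ∑ s' ∈ s.powerset, (-1 : ℝ) ^ (s \ s').card * μ.real ((⋂ σ ∈ s, F σ s') ∩ Φ s' ⁻¹' B) := by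
  have hAm : Measurable A := measurable_actual Φ F S A hΦ hF hS hA
  have hE : ∀ s s' : Finset ι, MeasurableSet ((⋂ σ ∈ s, F σ s') ∩ Φ s' ⁻¹' B) := fun s s' =>
    (s.measurableSet_biInter fun σ _ => hF σ s').inter (hΦ s' hB)
  -- the pointwise identity behind the expansion
  have hpt : ∀ ω : Ω, (A ⁻¹' B).indicator (1 : Ω → ℝ) ω =
      ∑ s' : Finset ι, ∑ t ∈ (Finset.univ \ s').powerset,
        (-1 : ℝ) ^ ((s' ∪ t) \ s').card * (((⋂ σ ∈ s' ∪ t, F σ s') ∩ Φ s' ⁻¹' B).indicator (1 : Ω → ℝ) ω) := by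
    intro ω
    -- `1_{A⁻¹B}(ω) = Σ_{s'} 1_{S=s'}(ω) · 1_B(Φ s' ω)`
    have h1 : (A ⁻¹' B).indicator (1 : Ω → ℝ) ω =
        ∑ s' : Finset ι, ({ω : Ω | S ω = s'}).indicator (1 : Ω → ℝ) ω * (Φ s' ⁻¹' B).indicator (1 : Ω → ℝ) ω := by
      rw [Finset.sum_eq_single (S ω)]
      · rw [indicator_of_mem (show ω ∈ {ω' : Ω | S ω' = S ω} from rfl), Pi.one_apply, one_mul]
        by_cases hω : A ω ∈ B
        · rw [indicator_of_mem (show ω ∈ A ⁻¹' B from hω), indicator_of_mem (show ω ∈ Φ (S ω) ⁻¹' B by rw [mem_preimage, ← hA ω]; exact hω)]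
        · rw [indicator_of_notMem (show ω ∉ A ⁻¹' B from hω), indicator_of_notMem (show ω ∉ Φ (S ω) ⁻¹' B by rw [mem_preimage, ← hA ω]; exact hω)]
      · intro s' _ hs'
        rw [indicator_of_notMem (show ω ∉ {ω' : Ω | S ω' = s'} from fun h => hs' h.symm), zero_mul]
      · intro h; exact absurd (Finset.mem_univ _) h
    rw [h1]
    refine Finset.sum_congr rfl fun s' _ => ?_
    rw [indicator_fiber_eq_prod F S hS s' ω, prod_one_sub_eq_sum_powerset, Finset.mul_sum, Finset.sum_mul]
    refine Finset.sum_congr rfl fun t ht => ?_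
    have ht' : t ⊆ Finset.univ \ s' := Finset.mem_powerset.1 ht
    have hdis : Disjoint s' t := by
      rw [Finset.disjoint_left]
      intro τ hτ hτt
      exact (Finset.mem_sdiff.1 (ht' hτt)).2 hτ
    rw [Finset.union_sdiff_cancel_left hdis, ← prod_indicator_mul_indicator_preimage, Finset.prod_union hdis]
    ring
  -- integrate the pointwise identity
  have hint : ∀ (s' t : Finset ι), Integrable (fun ω => (-1 : ℝ) ^ ((s' ∪ t) \ s').card *
      (((⋂ σ ∈ s' ∪ t, F σ s') ∩ Φ s' ⁻¹' B).indicator (1 : Ω → ℝ) ω)) μ := fun s' t =>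
    ((integrable_const (1 : ℝ)).indicator (hE (s' ∪ t) s')).const_mul _
  calc μ.real (A ⁻¹' B) = ∫ ω, (A ⁻¹' B).indicator (1 : Ω → ℝ) ω ∂μ := (integral_indicator_one (hAm hB)).symm
    _ = ∫ ω, ∑ s' : Finset ι, ∑ t ∈ (Finset.univ \ s').powerset,
          (-1 : ℝ) ^ ((s' ∪ t) \ s').card * (((⋂ σ ∈ s' ∪ t, F σ s') ∩ Φ s' ⁻¹' B).indicator (1 : Ω → ℝ) ω) ∂μ :=
        integral_congr_ae (Filter.Eventually.of_forall hpt)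
    _ = ∑ s' : Finset ι, ∑ t ∈ (Finset.univ \ s').powerset,
          (-1 : ℝ) ^ ((s' ∪ t) \ s').card * μ.real ((⋂ σ ∈ s' ∪ t, F σ s') ∩ Φ s' ⁻¹' B) := by
        rw [integral_finsetSum _ fun s' _ => integrable_finsetSum _ fun t _ => hint s' t]
        refine Finset.sum_congr rfl fun s' _ => ?_
        rw [integral_finsetSum _ fun t _ => hint s' t]
        refine Finset.sum_congr rfl fun t _ => ?_
        rw [integral_const_mul, integral_indicator_one (hE (s' ∪ t) s')]
    _ = ∑ s : Finset ι, ∑ s' ∈ s.powerset, (-1 : ℝ) ^ (s \ s').card * μ.real ((⋂ σ ∈ s, F σ s') ∩ Φ s' ⁻¹' B) :=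
        sum_sum_powerset_compl_eq fun s s' => (-1 : ℝ) ^ (s \ s').card * μ.real ((⋂ σ ∈ s, F σ s') ∩ Φ s' ⁻¹' B)

end Expansion

/-! ## §2 Mute cancellation and the domination principle -/

section Domination

variable {Ω Y ι : Type*} [MeasurableSpace Ω] [MeasurableSpace Y] [Fintype ι] [DecidableEq ι]
  (μ : Measure Ω) [IsFiniteMeasure μ] (Φ : Finset ι → Ω → Y) (F : ι → Finset ι → Set Ω) (S : Ω → Finset ι) (A : Ω → Y)

omit [MeasurableSpace Y] [Fintype ι] [IsFiniteMeasure μ] in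
/-- ★★ **(M ⇒ 0) A CONSTRAINED SET WITH A MUTE SITE CONTRIBUTES NOTHING**: if `σ ∈ s` and flipping the branch at `σ` leaves the measure of
`(∩_{τ∈s} F τ ·) ∩ (Φ ·)⁻¹B` unchanged for every `s' ⊆ s ∌ σ`, then `Σ_{s'⊆s} (−1)^{|s∖s'|} μ((∩_{τ∈s}F τ s') ∩ (Φ s')⁻¹B) = 0`. [folklore] -/
theorem branchSum_eq_zero_of_mute (s : Finset ι) {σ : ι} (hσ : σ ∈ s) (B : Set Y)
    (hmute : ∀ s' ⊆ s, σ ∉ s' →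
      μ ((⋂ τ ∈ s, F τ (insert σ s')) ∩ Φ (insert σ s') ⁻¹' B) = μ ((⋂ τ ∈ s, F τ s') ∩ Φ s' ⁻¹' B)) :
    ∑ s' ∈ s.powerset, (-1 : ℝ) ^ (s \ s').card * μ.real ((⋂ τ ∈ s, F τ s') ∩ Φ s' ⁻¹' B) = 0 :=
  alternatingSum_powerset_eq_zero_of_pairing s _ hσ fun s' hs' hσ' => by
    simp only [measureReal_def, hmute s' hs' hσ']

/-- ★★★ **DOMINATION, SET FORM**: given a class `𝓜` of constrained sets each having a mute site, for every measurable `B`,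
`μ(A⁻¹B) ≤ Σ_{s ∉ 𝓜} Σ_{s'⊆s} μ((∩_{σ∈s}F σ s') ∩ (Φ s')⁻¹B)` (the mute classes drop out of (E); the live ones are bounded by dropping the signs). [folklore] -/
theorem measure_preimage_actual_le_sum_live (hΦ : ∀ s, Measurable (Φ s)) (hF : ∀ σ s, MeasurableSet (F σ s))
    (hS : ∀ ω s, S ω = s ↔ ∀ σ, (σ ∈ s ↔ ω ∈ F σ s)) (hA : ∀ ω, A ω = Φ (S ω) ω) (𝓜 : Finset (Finset ι))
    (hM : ∀ s ∈ 𝓜, ∃ σ ∈ s, ∀ s' ⊆ s, σ ∉ s' → ∀ B : Set Y, MeasurableSet B →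
      μ ((⋂ τ ∈ s, F τ (insert σ s')) ∩ Φ (insert σ s') ⁻¹' B) = μ ((⋂ τ ∈ s, F τ s') ∩ Φ s' ⁻¹' B))
    {B : Set Y} (hB : MeasurableSet B) :
    μ (A ⁻¹' B) ≤ ∑ s ∈ Finset.univ \ 𝓜, ∑ s' ∈ s.powerset, μ ((⋂ σ ∈ s, F σ s') ∩ Φ s' ⁻¹' B) := by
  have hexp := measureReal_preimage_actual_eq_branchExpansion μ Φ F S A hΦ hF hS hA hB
  -- split the outer sum into the mute part (zero) and the live part
  have hsplit : ∑ s : Finset ι, ∑ s' ∈ s.powerset, (-1 : ℝ) ^ (s \ s').card * μ.real ((⋂ σ ∈ s, F σ s') ∩ Φ s' ⁻¹' B) =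
      ∑ s ∈ Finset.univ \ 𝓜, ∑ s' ∈ s.powerset, (-1 : ℝ) ^ (s \ s').card * μ.real ((⋂ σ ∈ s, F σ s') ∩ Φ s' ⁻¹' B) := by
    rw [← Finset.sum_sdiff (Finset.subset_univ 𝓜)]
    have hzero : ∑ s ∈ 𝓜, ∑ s' ∈ s.powerset, (-1 : ℝ) ^ (s \ s').card * μ.real ((⋂ σ ∈ s, F σ s') ∩ Φ s' ⁻¹' B) = 0 :=
      Finset.sum_eq_zero fun s hs => by
        obtain ⟨σ, hσ, hpair⟩ := hM s hs
        exact branchSum_eq_zero_of_mute μ Φ F s hσ B fun s' hs' hσ' => hpair s' hs' hσ' B hB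
    rw [hzero, add_zero]
  -- drop the signs on the live part
  have hreal : μ.real (A ⁻¹' B) ≤ ∑ s ∈ Finset.univ \ 𝓜, ∑ s' ∈ s.powerset, μ.real ((⋂ σ ∈ s, F σ s') ∩ Φ s' ⁻¹' B) := by
    rw [hexp, hsplit]
    refine Finset.sum_le_sum fun s _ => Finset.sum_le_sum fun s' _ => ?_
    have h0 : 0 ≤ μ.real ((⋂ σ ∈ s, F σ s') ∩ Φ s' ⁻¹' B) := measureReal_nonneg
    rcases neg_one_pow_eq_or ℝ (s \ s').card with h | h
    · rw [h, one_mul]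
    · rw [h]; linarith
  -- back to `ℝ≥0∞` (everything is finite)
  have hfin : ∀ s s' : Finset ι, μ ((⋂ σ ∈ s, F σ s') ∩ Φ s' ⁻¹' B) ≠ ∞ := fun s s' => measure_ne_top μ _
  calc μ (A ⁻¹' B) = ENNReal.ofReal (μ.real (A ⁻¹' B)) := (ENNReal.ofReal_toReal (measure_ne_top μ _)).symm
    _ ≤ ENNReal.ofReal (∑ s ∈ Finset.univ \ 𝓜, ∑ s' ∈ s.powerset, μ.real ((⋂ σ ∈ s, F σ s') ∩ Φ s' ⁻¹' B)) :=
        ENNReal.ofReal_le_ofReal hreal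
    _ = ∑ s ∈ Finset.univ \ 𝓜, ∑ s' ∈ s.powerset, μ ((⋂ σ ∈ s, F σ s') ∩ Φ s' ⁻¹' B) := by
        rw [ENNReal.ofReal_sum_of_nonneg fun s _ => Finset.sum_nonneg fun s' _ => measureReal_nonneg]
        refine Finset.sum_congr rfl fun s _ => ?_
        rw [ENNReal.ofReal_sum_of_nonneg fun s' _ => measureReal_nonneg]
        refine Finset.sum_congr rfl fun s' _ => ?_
        exact ENNReal.ofReal_toReal (hfin s s')

/-- ★★★ **DOMINATION, MEASURE FORM — THE LETTER IN WHICH hTop IS ASSEMBLED**: with a mute class `𝓜` as above and ACTIVITY weights `w s` such that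
`μ((∩_{σ∈s}F σ s') ∩ (Φ s')⁻¹B) ≤ w s · ν B` for every live `s`, every `s' ⊆ s` and every measurable `B`, the actual push-forward is dominated:
**`μ.map A ≤ (Σ_{s∉𝓜} 2^{|s|}·w s) • ν`**.  (In the model: `𝓜` = sets with a mute site by (M), `w s = (K_α·p_adm)^{|s|}` by (A), and the prefactor is bounded by the
exploration-tree count (C), K-uniformly.) [folklore] -/
theorem map_actual_le_smul_of_branchExpansion (hΦ : ∀ s, Measurable (Φ s)) (hF : ∀ σ s, MeasurableSet (F σ s))
    (hS : ∀ ω s, S ω = s ↔ ∀ σ, (σ ∈ s ↔ ω ∈ F σ s)) (hA : ∀ ω, A ω = Φ (S ω) ω) (𝓜 : Finset (Finset ι))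
    (hM : ∀ s ∈ 𝓜, ∃ σ ∈ s, ∀ s' ⊆ s, σ ∉ s' → ∀ B : Set Y, MeasurableSet B →
      μ ((⋂ τ ∈ s, F τ (insert σ s')) ∩ Φ (insert σ s') ⁻¹' B) = μ ((⋂ τ ∈ s, F τ s') ∩ Φ s' ⁻¹' B))
    (ν : Measure Y) (w : Finset ι → ℝ≥0∞)
    (hw : ∀ s : Finset ι, s ∉ 𝓜 → ∀ s' ⊆ s, ∀ B : Set Y, MeasurableSet B → μ ((⋂ σ ∈ s, F σ s') ∩ Φ s' ⁻¹' B) ≤ w s * ν B) :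
    μ.map A ≤ (∑ s ∈ Finset.univ \ 𝓜, 2 ^ s.card * w s) • ν := by
  have hAm : Measurable A := measurable_actual Φ F S A hΦ hF hS hA
  refine Measure.le_iff.2 fun B hB => ?_
  rw [Measure.map_apply hAm hB, Measure.smul_apply, smul_eq_mul]
  calc μ (A ⁻¹' B) ≤ ∑ s ∈ Finset.univ \ 𝓜, ∑ s' ∈ s.powerset, μ ((⋂ σ ∈ s, F σ s') ∩ Φ s' ⁻¹' B) :=
        measure_preimage_actual_le_sum_live μ Φ F S A hΦ hF hS hA 𝓜 hM hB
    _ ≤ ∑ s ∈ Finset.univ \ 𝓜, ∑ s' ∈ s.powerset, w s * ν B :=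
        Finset.sum_le_sum fun s hs => Finset.sum_le_sum fun s' hs' =>
          hw s (Finset.mem_sdiff.1 hs).2 s' (Finset.mem_powerset.1 hs') B hB
    _ = (∑ s ∈ Finset.univ \ 𝓜, 2 ^ s.card * w s) * ν B := by
        rw [Finset.sum_mul]
        refine Finset.sum_congr rfl fun s _ => ?_
        rw [Finset.sum_const, Finset.card_powerset, nsmul_eq_mul, mul_assoc]
        norm_cast

end Domination

/-! ## §3 (A₃) Monotone stacking of one-level restricted push-forward bounds along a chain of maps -/

section Stacking

variable {X : ℕ → Type*} [∀ k, MeasurableSpace (X k)] (lam : (k : ℕ) → Measure (X k)) (T : (k : ℕ) → X k → X (k + 1))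
  (E : (k : ℕ) → Set (X k)) (V : (k : ℕ) → X 0 → X k)

/-- The composite `V k` of measurable one-step maps (given by the recursion `V 0 = id`, `V (k+1) = T k ∘ V k`) is measurable. [folklore] -/
theorem measurable_iterate (hT : ∀ k, Measurable (T k)) (hV0 : ∀ x, V 0 x = x) (hVs : ∀ k x, V (k + 1) x = T k (V k x)) :
    ∀ k, Measurable (V k)
  | 0 => by
    have h : V 0 = id := funext hV0
    rw [h]; exact measurable_id
  | k + 1 => by
    have h : V (k + 1) = T k ∘ V k := funext (hVs k)
    rw [h]; exact (hT k).comp (measurable_iterate hT hV0 hVs k)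

/-- ★★ **(A₃) MONOTONE STACKING**: if every one-level RESTRICTED push-forward is dominated, `((λ_k)↾E_k).map T_k ≤ c_k • λ_{k+1}`, then along the chain
`V_{k+1} = T_k ∘ V_k` the push-forward of `λ_0` restricted to «every level's event holds along the trajectory» is dominated by the product:
`((λ_0)↾{∀ k < n, V_k ∈ E_k}).map V_n ≤ (∏_{k<n} c_k) • λ_n` — pure monotonicity of restriction and push-forward (no densities). [folklore] -/
theorem map_restrict_iterate_le_prod_smul (hT : ∀ k, Measurable (T k)) (hE : ∀ k, MeasurableSet (E k)) (hV0 : ∀ x, V 0 x = x)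
    (hVs : ∀ k x, V (k + 1) x = T k (V k x)) (c : ℕ → ℝ≥0∞) (hstep : ∀ k, ((lam k).restrict (E k)).map (T k) ≤ c k • lam (k + 1)) :
    ∀ n : ℕ, ((lam 0).restrict {x | ∀ k < n, V k x ∈ E k}).map (V n) ≤ (∏ k ∈ Finset.range n, c k) • lam n
  | 0 => by
    have h : V 0 = id := funext hV0
    have hset : {x : X 0 | ∀ k < 0, V k x ∈ E k} = univ := eq_univ_of_forall fun x k hk => absurd hk (Nat.not_lt_zero k)
    rw [hset, Measure.restrict_univ, h, Measure.map_id, Finset.range_zero, Finset.prod_empty, one_smul]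
  | n + 1 => by
    have hVm := measurable_iterate T V hT hV0 hVs
    have ih := map_restrict_iterate_le_prod_smul hT hE hV0 hVs c hstep n
    -- split the event set at the top level
    have hset : {x : X 0 | ∀ k < n + 1, V k x ∈ E k} = V n ⁻¹' E n ∩ {x : X 0 | ∀ k < n, V k x ∈ E k} := by
      ext x
      simp only [mem_setOf_eq, mem_inter_iff, mem_preimage]
      constructor
      · intro h
        exact ⟨h n (Nat.lt_succ_self n), fun k hk => h k (Nat.lt_succ_of_lt hk)⟩
      · rintro ⟨hn, h⟩ k hk
        rcases Nat.lt_succ_iff_lt_or_eq.1 hk with hk' | rfl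
        · exact h k hk'
        · exact hn
    have hSn : MeasurableSet {x : X 0 | ∀ k < n, V k x ∈ E k} := by
      have : {x : X 0 | ∀ k < n, V k x ∈ E k} = ⋂ k ∈ Finset.range n, V k ⁻¹' E k := by
        ext x; simp
      rw [this]
      exact (Finset.range n).measurableSet_biInter fun k _ => hVm k (hE k)
    have hcomp : V (n + 1) = T n ∘ V n := funext (hVs n)
    rw [hset, ← Measure.restrict_restrict (hVm n (hE n)), hcomp, ← Measure.map_map (hT n) (hVm n),
      ← Measure.restrict_map (hVm n) (hE n)]
    calc ((((lam 0).restrict {x : X 0 | ∀ k < n, V k x ∈ E k}).map (V n)).restrict (E n)).map (T n)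
        ≤ (((∏ k ∈ Finset.range n, c k) • lam n).restrict (E n)).map (T n) :=
          Measure.map_mono (Measure.restrict_mono (subset_refl _) ih) (hT n)
      _ = (∏ k ∈ Finset.range n, c k) • (((lam n).restrict (E n)).map (T n)) := by
          rw [Measure.restrict_smul, Measure.map_smul]
      _ ≤ (∏ k ∈ Finset.range n, c k) • (c n • lam (n + 1)) := by
          refine Measure.le_iff.2 fun s _ => ?_
          simp only [Measure.smul_apply, smul_eq_mul]
          exact mul_le_mul' le_rfl (Measure.le_iff'.1 (hstep n) s)
      _ = (∏ k ∈ Finset.range (n + 1), c k) • lam (n + 1) := by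
          rw [Finset.prod_range_succ, smul_smul]

/-- ★★ **(A₃′) MONOTONE STACKING UP TO A FIXED HEIGHT**: the same as `map_restrict_iterate_le_prod_smul` when the one-level restricted push-forward bounds are available
only for the levels `k < n` actually traversed (in the model: the standing range `j + k + 1 ≤ m + K`). [folklore] -/
theorem map_restrict_iterate_le_prod_smul_of_lt (hT : ∀ k, Measurable (T k)) (hE : ∀ k, MeasurableSet (E k)) (hV0 : ∀ x, V 0 x = x)
    (hVs : ∀ k x, V (k + 1) x = T k (V k x)) (c : ℕ → ℝ≥0∞) :
    ∀ n : ℕ, (∀ k < n, ((lam k).restrict (E k)).map (T k) ≤ c k • lam (k + 1)) →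
      ((lam 0).restrict {x | ∀ k < n, V k x ∈ E k}).map (V n) ≤ (∏ k ∈ Finset.range n, c k) • lam n
  | 0, _ => by
    have h : V 0 = id := funext hV0
    have hset : {x : X 0 | ∀ k < 0, V k x ∈ E k} = univ := eq_univ_of_forall fun x k hk => absurd hk (Nat.not_lt_zero k)
    rw [hset, Measure.restrict_univ, h, Measure.map_id, Finset.range_zero, Finset.prod_empty, one_smul]
  | n + 1, hstep => by
    have hVm := measurable_iterate T V hT hV0 hVs
    have ih := map_restrict_iterate_le_prod_smul_of_lt hT hE hV0 hVs c n fun k hk => hstep k (Nat.lt_succ_of_lt hk)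
    have hset : {x : X 0 | ∀ k < n + 1, V k x ∈ E k} = V n ⁻¹' E n ∩ {x : X 0 | ∀ k < n, V k x ∈ E k} := by
      ext x
      simp only [mem_setOf_eq, mem_inter_iff, mem_preimage]
      constructor
      · intro h
        exact ⟨h n (Nat.lt_succ_self n), fun k hk => h k (Nat.lt_succ_of_lt hk)⟩
      · rintro ⟨hn, h⟩ k hk
        rcases Nat.lt_succ_iff_lt_or_eq.1 hk with hk' | rfl
        · exact h k hk'
        · exact hn
    have hcomp : V (n + 1) = T n ∘ V n := funext (hVs n)
    rw [hset, ← Measure.restrict_restrict (hVm n (hE n)), hcomp, ← Measure.map_map (hT n) (hVm n),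
      ← Measure.restrict_map (hVm n) (hE n)]
    calc ((((lam 0).restrict {x : X 0 | ∀ k < n, V k x ∈ E k}).map (V n)).restrict (E n)).map (T n)
        ≤ (((∏ k ∈ Finset.range n, c k) • lam n).restrict (E n)).map (T n) :=
          Measure.map_mono (Measure.restrict_mono (subset_refl _) ih) (hT n)
      _ = (∏ k ∈ Finset.range n, c k) • (((lam n).restrict (E n)).map (T n)) := by
          rw [Measure.restrict_smul, Measure.map_smul]
      _ ≤ (∏ k ∈ Finset.range n, c k) • (c n • lam (n + 1)) := by
          refine Measure.le_iff.2 fun s _ => ?_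
          simp only [Measure.smul_apply, smul_eq_mul]
          exact mul_le_mul' le_rfl (Measure.le_iff'.1 (hstep n (Nat.lt_succ_self n)) s)
      _ = (∏ k ∈ Finset.range (n + 1), c k) • lam (n + 1) := by
          rw [Finset.prod_range_succ, smul_smul]

end Stacking

end Summit.QuantumFields.YangMills.Theorems.UV3BranchExpansionDomination

end
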